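import Summits.MatrixMultiplication.MatrixMultiplication.Theorems.ObstructionDescentUniversalOccurrenceTwoRectangleOddHookTableaux

set_option linter.dupNamespace false
set_option autoImplicit false

/-!
# Universal occurrence — two rectangles and the type `(2N-7,5,1,1)`, part A: the tableau (decomp-mm · lens 3 · gen 44)

Route `route-MatrixMultiplication-ObstructionDescent` (sub-problem `MatrixMultiplication`, `ω(ℂ) = 2`); SUPPORT for the crux
`NoOccurrenceObstruction` (`P_O`, item `stmt-MatrixMultiplication-29040`) through the universal-occurrence programme; the
combinatorial input of the THIRD FOUR-ODD FAMILY `((2^N),(2^N),(2N-7,5,1,1)) ∈ S(⟨m⟩)`, `m ≥ N + 2`, `N ≥ 6` (part E,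
`…TwoRectangleOddFive`).  No `def`, no `sorry`.

The tableau `T` of shape `(2N-7,5,1,1)` on the positions `[2N]`: the COLUMN `p ↦ (p,0)` for `p < 4`, the four DOMINOES
`2k+4 ↦ (0,k+1), 2k+5 ↦ (1,k+1)` (`k < 4`), and the ARM `p ↦ (0, p-7)` for `p ≥ 12` (a standard filling for the position order).
§1: cells, membership, standardness.  §2: the SUPPORT of the polytabloid `e_T` (a word `u` with `e_T(u) ≠ 0` vanishes on the arm,
reads four distinct letters `< 4` down the column and the two letters `{0,1}` down each domino).  The VALUE of `e_T` on its support
(`sgn(column reading) · ∏_k (-1)^{u(2k+4)}`) is part A′ (`…TwoRectangleOddFiveSign`).  Third uniform family of the FOUR-ODD class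
(memo NODE-g44 §4: the hook-domino families `(2N-2j-3,2j+1,1,1)`, here `j = 2`).

[cite: BurgisserIkenmeyer2011, Thm. 4.4] [cite: BurgisserIkenmeyer2017, §5, Thm. 5.9 (proof of (2))] (polytabloids = highest
weight vectors of `V^{⊗d}`: folklore, e.g. Fulton, Young Tableaux, §7–8)
-/

noncomputable section

open scoped BigOperators

namespace Summit.MatrixMultiplication.MatrixMultiplication.Theorems.ObstructionCalculus

open Literature.Computability.AlgebraicComplexity
open Literature.NumberTheory.DiophantineGeometry

/-! ### §1 The tableau: column `0..3`, dominoes `4,5`, `6,7`, `8,9`, `10,11`, then the arm -/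

/-- Cells of the `(2N-7,5,1,1)` tableau are distinct. [folklore] -/
theorem oddFiveCell_injective {p q : ℕ}
    (hpq : (if p < 4 then (p, 0) else if p < 12 then (p % 2, p / 2 - 1) else (0, p - 7) : ℕ × ℕ) =
      (if q < 4 then (q, 0) else if q < 12 then (q % 2, q / 2 - 1) else (0, q - 7))) : p = q := by
  split_ifs at hpq <;> simp only [Prod.mk.injEq] at hpq <;> omega

/-- The `(2N-7,5,1,1)` tableau is a standard filling for the position order. [folklore] -/
theorem oddFiveCell_standard {p q : ℕ} (hpq : p < q) :
    ¬ ((if q < 4 then (q, 0) else if q < 12 then (q % 2, q / 2 - 1) else (0, q - 7) : ℕ × ℕ) ≤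
      (if p < 4 then (p, 0) else if p < 12 then (p % 2, p / 2 - 1) else (0, p - 7))) := by
  split_ifs <;> simp only [Prod.mk_le_mk] <;> omega

/-- The Young diagram of `(2N-7,5,1,1)`: its boxes. [folklore] -/
theorem mem_youngDiagram_oddFive {N : ℕ} (ν : Nat.Partition (N * 2)) (hν : ν.sortedParts = [2 * N - 7, 5, 1, 1])
    {r c : ℕ} (h : (r = 0 ∧ c < 2 * N - 7) ∨ (r = 1 ∧ c < 5) ∨ (2 ≤ r ∧ r < 4 ∧ c = 0)) : (r, c) ∈ ν.youngDiagram := by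
  rw [Nat.Partition.mem_youngDiagram_iff, hν]
  rcases h with ⟨rfl, hc⟩ | ⟨rfl, hc⟩ | ⟨hr2, hr4, rfl⟩
  · exact ⟨by simp, by simpa using hc⟩
  · exact ⟨by simp, by simpa using hc⟩
  · have hr : r = 2 ∨ r = 3 := by omega
    rcases hr with rfl | rfl <;> exact ⟨by simp, by simp⟩

/-- `(2N-7,5,1,1)` has four rows. [folklore] -/
theorem fst_lt_of_mem_youngDiagram_oddFive {N : ℕ} (ν : Nat.Partition (N * 2))
    (hν : ν.sortedParts = [2 * N - 7, 5, 1, 1]) {x : ℕ × ℕ} (hx : x ∈ ν.youngDiagram.cells) : x.1 < 4 := by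
  obtain ⟨h, -⟩ := (Nat.Partition.mem_youngDiagram_iff ν x).1 ((YoungDiagram.mem_cells _).1 hx)
  rw [hν] at h
  simpa using h

/-- The cells of the tableau lie in `(2N-7,5,1,1)` (`6 ≤ N`). [folklore] -/
theorem oddFiveCell_mem {N : ℕ} (hN : 6 ≤ N) (ν : Nat.Partition (N * 2)) (hν : ν.sortedParts = [2 * N - 7, 5, 1, 1])
    (p : ℕ) (hp : p < N * 2) :
    (if p < 4 then (p, 0) else if p < 12 then (p % 2, p / 2 - 1) else (0, p - 7) : ℕ × ℕ) ∈ ν.youngDiagram := by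
  split_ifs with h1 h2 <;> apply mem_youngDiagram_oddFive ν hν
  · have h : p = 0 ∨ p = 1 ∨ (2 ≤ p ∧ p < 4) := by omega
    rcases h with rfl | rfl | h
    · left; constructor <;> omega
    · right; left; constructor <;> omega
    · right; right; refine ⟨h.1, h.2, rfl⟩
  · have h : p % 2 = 0 ∨ p % 2 = 1 := by omega
    rcases h with h | h <;> rw [h]
    · left; constructor <;> omega
    · right; left; constructor <;> omega
  · left; constructor <;> omega

/-! ### §2 Support of the polytabloid `e_T` -/

/-- **Support of `e_T`.**  If `e_T(u) ≠ 0` then `u` vanishes on the arm, reads four distinct letters `< 4` down the column,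
and reads the two letters `0, 1` down each domino. [folklore] -/
theorem oddFiveTableau_support {N : ℕ} {Y : YoungDiagram} (hN : ∀ x ∈ Y.cells, x.1 < N) (T : StdFilling (N * 2) Y)
    (hT : ∀ p : Fin (N * 2), T.1 p =
      (if (p : ℕ) < 4 then ((p : ℕ), 0) else if (p : ℕ) < 12 then ((p : ℕ) % 2, (p : ℕ) / 2 - 1) else (0, (p : ℕ) - 7)))
    {u : Word N (N * 2)} (hu : T.polytabloid ℂ hN u ≠ 0) :
    (∀ p : Fin (N * 2), 12 ≤ (p : ℕ) → ((u p : Fin N) : ℕ) = 0) ∧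
    (∀ p : Fin (N * 2), (p : ℕ) < 4 → ((u p : Fin N) : ℕ) < 4) ∧
    (∀ p q : Fin (N * 2), (p : ℕ) < 4 → (q : ℕ) < 4 → u p = u q → p = q) ∧
    (∀ p : Fin (N * 2), 4 ≤ (p : ℕ) → (p : ℕ) < 12 → ((u p : Fin N) : ℕ) < 2) ∧
    (∀ p q : Fin (N * 2), 4 ≤ (p : ℕ) → (q : ℕ) < 12 → (q : ℕ) = (p : ℕ) + 1 → (p : ℕ) % 2 = 0 →
      ((u p : Fin N) : ℕ) + ((u q : Fin N) : ℕ) = 1) := by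
  classical
  obtain ⟨σ, hσ, rfl⟩ := StdFilling.exists_of_polytabloid_apply_ne_zero hN T hu
  have hcol : ∀ p, (T.1 (σ p)).2 = (T.1 p).2 := StdFilling.mem_colStab.1 hσ
  have hval : ∀ p, ((StdFilling.rowWord hN T ∘ ⇑σ) p : ℕ) = (T.1 (σ p)).1 := fun p => rfl
  have hrow' : ∀ q : Fin (N * 2), (T.1 q).1 =
      if (q : ℕ) < 4 then (q : ℕ) else if (q : ℕ) < 12 then (q : ℕ) % 2 else 0 := fun q => by
    rw [hT]; split_ifs <;> rfl
  have hcol' : ∀ q : Fin (N * 2), (T.1 q).2 =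
      if (q : ℕ) < 4 then 0 else if (q : ℕ) < 12 then (q : ℕ) / 2 - 1 else (q : ℕ) - 7 := fun q => by
    rw [hT]; split_ifs <;> rfl
  refine ⟨fun p hp => ?_, fun p hp => ?_, fun p q hp hq hpq => ?_, fun p hp hp' => ?_, fun p q hp hq hqp hp2 => ?_⟩
  · have hc := hcol p
    rw [hcol', hcol'] at hc
    rw [hval, hrow']
    split_ifs at hc ⊢ <;> omega
  · have hc := hcol p
    rw [hcol', hcol'] at hc
    rw [hval, hrow']
    split_ifs at hc ⊢ <;> omega
  · have hr : (T.1 (σ p)).1 = (T.1 (σ q)).1 := by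
      rw [← hval, ← hval]; exact congrArg Fin.val hpq
    have hc : (T.1 (σ p)).2 = (T.1 (σ q)).2 := by
      rw [hcol, hcol, hcol', hcol', if_pos hp, if_pos hq]
    exact σ.injective (T.injective (Prod.ext hr hc))
  · have hc := hcol p
    rw [hcol', hcol'] at hc
    rw [hval, hrow']
    split_ifs at hc ⊢ <;> omega
  · have hcp := hcol p
    have hcq := hcol q
    rw [hcol', hcol'] at hcp hcq
    have hne : ((σ p : Fin (N * 2)) : ℕ) ≠ ((σ q : Fin (N * 2)) : ℕ) := fun h =>
      absurd (congrArg Fin.val (σ.injective (Fin.ext h))) (by omega)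
    rw [hval, hval, hrow', hrow']
    split_ifs at hcp hcq ⊢ <;> omega


end Summit.MatrixMultiplication.MatrixMultiplication.Theorems.ObstructionCalculus

end
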